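/-
Copyright: H21 programme, solo seat `solo-RiemannHypothesis-informed` (session 4).
-/
import Summits.RiemannHypothesis.RiemannHypothesis.Theorems.SoloInformedSampling
import Literature.NumberTheory.LFunctions.ZetaZerosReflection

/-!
# Local sampling bound: what local RH near `γ₀` buys (solo-informed, T11–T12)

`SoloInformedSampling` bounds the zero-sampling energy of a window test `g = h·e^{−iγ₀t}`,
`tsupport h ⊆ [-a, a]`, by `2A₁ e^{a}(‖h‖₁² + ‖h′‖₁²) log(|γ₀|+2)` with NO hypothesis on the
zeros; the factor `e^{a}` is the price of zeros possibly anywhere in the closed strip.  Here we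
quantify what a LOCAL hypothesis removes.  Suppose every zero `ρ` with `0 ≤ Re ρ ≤ 1` and
`|Im ρ − γ₀| < R` (`R ≥ 1`) lies on the critical line, except possibly those in a prescribed
finite set `S`.  Then

`∑_{ρ ∈ weilZeroIndex T} m(ρ)|ĝ(ρ)|²
   ≤ 2A₁ ( (‖h‖₁² + ‖h′‖₁²) + 2e^{a} ‖h⁽ⁿ⁺¹⁾‖₁² / R^{2n} ) log(|γ₀|+2) + ∑_{ρ ∈ S} m(ρ)|ĝ(ρ)|²`

for every `n : ℕ` (`exists_weilSamplingEnergy_le_local`): the near zeros are sampled on the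
line, where `|ĝ|` has no exponential factor (`norm_sq_weilMellin_twist_le_kernel_critical`), and
the far zeros (`|Im ρ − γ₀| ≥ R`, anywhere in the strip) are suppressed by the order-`(n+1)` decay
of `ĥ` (`norm_sq_weilMellin_twist_le_kernel_far`).  Feeding this into the dodged odd dipole
(`SoloInformedDodging`) with `S = {ρ₀, ρ₀*}` gives the **conditional visibility inequality**
`weilGroundEnergy_le_local_of_oddDipole`:

`ε(a)‖k‖₂² ≤ 2A₁ ( (‖k‖₁² + ‖k′‖₁²) + 2e^{a}‖k⁽ⁿ⁺¹⁾‖₁²/R^{2n} ) log(|γ₀|+2) − 2 m(ρ₀)(η²+τ²)²|∫ h e^{ηt}|²`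

(`k = D_τ h`), in which the main term carries NO `e^{a}`: the exponential price is confined to
the far zeros and is divided by `R^{2n}`.  This is the typed form of the statement (paper
(D6′)(v)) that a visibility THRESHOLD `a ≍ log γ₀` for an isolated off-line zero is available
exactly under local RH near `γ₀`; the remaining step (choice of `h`, `τ`, `n`, `R`) is real
analysis on explicit functions and is not done here.

Main results: `exists_finsum_weilZeroIndex_le_of_kernel_bound_off`,
`exists_weilSamplingEnergy_le_local`, `weilGroundEnergy_le_local_of_oddDipole`.
-/

open MeasureTheory Complex Set Filter Topology Literature.NumberTheory.LFunctions
open scoped ContDiff ComplexConjugate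

namespace Summit.RiemannHypothesis.RiemannHypothesis.Theorems

/-- **Critical-line majorant (no exponential factor).** For a Weil test `h` with
`tsupport h ⊆ [-a, a]` and `ρ` ON the critical line:
`|ĝ(ρ)|² ≤ (‖h‖₁² + ‖h′‖₁²)/(1 + (Im ρ − γ₀)²)` for `g = h·e^{−iγ₀t}`. -/
theorem norm_sq_weilMellin_twist_le_kernel_critical {h : ℝ → ℂ} (hh : IsWeilTest h) {a : ℝ}
    (hhs : tsupport h ⊆ Icc (-a) a) (γ₀ : ℝ) {ρ : ℂ} (hρ : ρ.re = 1 / 2) :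
    ‖weilMellin (fun t ↦ h t * cexp (-(γ₀ * I) * t)) ρ‖ ^ 2
      ≤ ((∫ t : ℝ, ‖h t‖) ^ 2 + (∫ t : ℝ, ‖deriv h t‖) ^ 2) / (1 + (ρ.im - γ₀) ^ 2) := by
  rw [weilMellin_mul_cexp]
  set s : ℂ := ρ + -(γ₀ * I) with hs
  set X : ℝ := ‖weilMellin h s‖ with hX
  set A : ℝ := ∫ t : ℝ, ‖h t‖ with hA
  set B : ℝ := ∫ t : ℝ, ‖deriv h t‖ with hB
  have hsre : s.re - 1 / 2 = 0 := by simp [hs, hρ]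
  have hsim : (s - 1 / 2).im = ρ.im - γ₀ := by simp [hs]; ring
  have hexp : Real.exp (|s.re - 1 / 2| * a) = 1 := by rw [hsre]; simp
  have h0 := norm_weilMellin_le_of_isWeilTest hh hhs 0 s
  simp only [pow_zero, one_mul, iteratedDeriv_zero, hexp] at h0
  have h1 := norm_weilMellin_le_of_isWeilTest hh hhs 1 s
  simp only [pow_one, iteratedDeriv_one, hexp, one_mul] at h1
  have hXnn : 0 ≤ X := norm_nonneg _
  have hX1 : |ρ.im - γ₀| * X ≤ B := by
    have him : |ρ.im - γ₀| ≤ ‖s - 1 / 2‖ := by rw [← hsim]; exact Complex.abs_im_le_norm _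
    calc |ρ.im - γ₀| * X ≤ ‖s - 1 / 2‖ * X := mul_le_mul_of_nonneg_right him hXnn
      _ ≤ B := h1
  have hsq0 : X ^ 2 ≤ A ^ 2 := pow_le_pow_left₀ hXnn h0 2
  have hsq1 : (ρ.im - γ₀) ^ 2 * X ^ 2 ≤ B ^ 2 := by
    have := pow_le_pow_left₀ (by positivity) hX1 2
    rw [mul_pow, sq_abs] at this
    exact this
  have hpos : 0 < 1 + (ρ.im - γ₀) ^ 2 := by positivity
  rw [le_div_iff₀ hpos]
  nlinarith

/-- **Far majorant with high-order decay.** For a Weil test `h` with `tsupport h ⊆ [-a, a]`,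
`a ≥ 0`, `n : ℕ`, `R ≥ 1`, and `ρ` in the closed strip with `|Im ρ − γ₀| ≥ R`:
`|ĝ(ρ)|² ≤ (2e^{a}‖h⁽ⁿ⁺¹⁾‖₁²/R^{2n}) / (1 + (Im ρ − γ₀)²)` for `g = h·e^{−iγ₀t}`. -/
theorem norm_sq_weilMellin_twist_le_kernel_far {h : ℝ → ℂ} (hh : IsWeilTest h) {a : ℝ}
    (ha : 0 ≤ a) (hhs : tsupport h ⊆ Icc (-a) a) (γ₀ : ℝ) (n : ℕ) {R : ℝ} (hR : 1 ≤ R)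
    {ρ : ℂ} (hρ0 : 0 ≤ ρ.re) (hρ1 : ρ.re ≤ 1) (hfar : R ≤ |ρ.im - γ₀|) :
    ‖weilMellin (fun t ↦ h t * cexp (-(γ₀ * I) * t)) ρ‖ ^ 2
      ≤ 2 * Real.exp a * (∫ t : ℝ, ‖iteratedDeriv (n + 1) h t‖) ^ 2 / R ^ (2 * n)
          / (1 + (ρ.im - γ₀) ^ 2) := by
  rw [weilMellin_mul_cexp]
  set s : ℂ := ρ + -(γ₀ * I) with hs
  set X : ℝ := ‖weilMellin h s‖ with hX
  set B : ℝ := ∫ t : ℝ, ‖iteratedDeriv (n + 1) h t‖ with hB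
  set y : ℝ := |ρ.im - γ₀| with hy
  have hsre : s.re = ρ.re := by simp [hs]
  have hsim : (s - 1 / 2).im = ρ.im - γ₀ := by simp [hs]; ring
  have hexp : Real.exp (|s.re - 1 / 2| * a) ≤ Real.exp (a / 2) := by
    apply Real.exp_le_exp.mpr
    have : |s.re - 1 / 2| ≤ 1 / 2 := by rw [hsre]; exact abs_le.mpr ⟨by linarith, by linarith⟩
    nlinarith
  have hB0 : 0 ≤ B := integral_nonneg fun t ↦ norm_nonneg _
  have hXnn : 0 ≤ X := norm_nonneg _
  have hy1 : 1 ≤ y := hR.trans hfar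
  have hy0 : 0 ≤ y := zero_le_one.trans hy1
  have hR0 : 0 ≤ R := zero_le_one.trans hR
  have hk := norm_weilMellin_le_of_isWeilTest hh hhs (n + 1) s
  have him : y ≤ ‖s - 1 / 2‖ := by rw [hy, ← hsim]; exact Complex.abs_im_le_norm _
  have hyX : y ^ (n + 1) * X ≤ Real.exp (a / 2) * B := by
    calc y ^ (n + 1) * X ≤ ‖s - 1 / 2‖ ^ (n + 1) * X :=
          mul_le_mul_of_nonneg_right (pow_le_pow_left₀ hy0 him _) hXnn
      _ ≤ Real.exp (|s.re - 1 / 2| * a) * B := hk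
      _ ≤ Real.exp (a / 2) * B := mul_le_mul_of_nonneg_right hexp hB0
  have hE : Real.exp (a / 2) ^ 2 = Real.exp a := by
    rw [← Real.exp_nat_mul]; congr 1; ring
  have key : (y ^ (n + 1) * X) ^ 2 ≤ Real.exp a * B ^ 2 := by
    have := pow_le_pow_left₀ (by positivity) hyX 2
    rw [mul_pow (Real.exp _), hE] at this
    exact this
  have hR2n : R ^ (2 * n) ≤ y ^ (2 * n) := pow_le_pow_left₀ hR0 hfar _
  have hysq : (ρ.im - γ₀) ^ 2 = y ^ 2 := (sq_abs _).symm
  have h1y : 1 + y ^ 2 ≤ 2 * y ^ 2 := by nlinarith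
  have hpos : 0 < R ^ (2 * n) * (1 + (ρ.im - γ₀) ^ 2) := by positivity
  rw [div_div, le_div_iff₀ hpos, hysq]
  have hprod : R ^ (2 * n) * (1 + y ^ 2) ≤ y ^ (2 * n) * (2 * y ^ 2) :=
    mul_le_mul hR2n h1y (by positivity) (pow_nonneg hy0 _)
  calc X ^ 2 * (R ^ (2 * n) * (1 + y ^ 2)) ≤ X ^ 2 * (y ^ (2 * n) * (2 * y ^ 2)) :=
        mul_le_mul_of_nonneg_left hprod (sq_nonneg X)
    _ = 2 * (y ^ (n + 1) * X) ^ 2 := by ring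
    _ ≤ 2 * (Real.exp a * B ^ 2) := by linarith
    _ = 2 * Real.exp a * B ^ 2 := by ring

/-- **Zero side under a Cauchy majorant with exceptions.** With the absolute constant `A₁` of
`exists_finsum_weilZeroIndex_le_of_kernel_bound`: if a non-negative weight `F` satisfies
`F(ρ) ≤ M/(1 + (Im ρ − γ₀)²)` at every point of the closed strip OUTSIDE a finite set `S` of
points `≠ 1`, then for every `T`,
`∑_{ρ ∈ weilZeroIndex T} m(ρ)F(ρ) ≤ 2A₁ M log(|γ₀|+2) + ∑_{ρ ∈ S} m(ρ)F(ρ)`. -/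
theorem exists_finsum_weilZeroIndex_le_of_kernel_bound_off :
    ∃ A₁ : ℝ, 0 < A₁ ∧ ∀ (F : ℂ → ℝ) (M γ₀ : ℝ) (S : Finset ℂ), 0 ≤ M → (∀ ρ, 0 ≤ F ρ) →
      (∀ ρ ∈ S, ρ ≠ 1) →
      (∀ ρ : ℂ, 0 ≤ ρ.re → ρ.re ≤ 1 → ρ ∉ S → F ρ ≤ M / (1 + (ρ.im - γ₀) ^ 2)) →
      ∀ T : ℝ, ∑ᶠ ρ ∈ weilZeroIndex T, (riemannZetaZeroOrder ρ : ℝ) * F ρ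
        ≤ 2 * A₁ * M * Real.log (|γ₀| + 2) + ∑ ρ ∈ S, (riemannZetaZeroOrder ρ : ℝ) * F ρ := by
  obtain ⟨A₁, hA₁, hK⟩ := exists_finsum_weilZeroIndex_le_of_kernel_bound
  refine ⟨A₁, hA₁, fun F M γ₀ S hM hF hS1 hmaj T ↦ ?_⟩
  classical
  set F' : ℂ → ℝ := fun ρ ↦ if ρ ∈ S then 0 else F ρ with hF'
  have hK' := hK F' M γ₀ hM (fun ρ h0 h1 ↦ by
    by_cases hρ : ρ ∈ S
    · simp only [hF', hρ, if_true]; positivity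
    · simp only [hF', hρ, if_false]; exact hmaj ρ h0 h1 hρ) T
  have hfin := weilZeroIndex_finite T
  rw [finsum_mem_eq_finite_toFinset_sum _ hfin] at hK' ⊢
  have hsplit : ∀ ρ, (riemannZetaZeroOrder ρ : ℝ) * F ρ =
      (riemannZetaZeroOrder ρ : ℝ) * F' ρ +
        (if ρ ∈ S then (riemannZetaZeroOrder ρ : ℝ) * F ρ else 0) := by
    intro ρ
    by_cases hρ : ρ ∈ S
    · simp only [hF', hρ, if_true, mul_zero, zero_add]
    · simp only [hF', hρ, if_false, add_zero]
  rw [Finset.sum_congr rfl fun ρ _ ↦ hsplit ρ, Finset.sum_add_distrib]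
  have hle : ∑ ρ ∈ hfin.toFinset, (if ρ ∈ S then (riemannZetaZeroOrder ρ : ℝ) * F ρ else 0)
      ≤ ∑ ρ ∈ S, (riemannZetaZeroOrder ρ : ℝ) * F ρ := by
    rw [← Finset.sum_filter]
    refine Finset.sum_le_sum_of_subset_of_nonneg (fun ρ hρ ↦ (Finset.mem_filter.mp hρ).2)
      fun ρ hρS _ ↦ ?_
    exact mul_nonneg (by exact_mod_cast riemannZetaZeroOrder_nonneg (hS1 ρ hρS)) (hF ρ)
  linarith

/-- **Local sampling-energy bound (T11).** There is an absolute `A₁ > 0` such that: for every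
Weil test `h` with `tsupport h ⊆ [-a, a]` (`a ≥ 0`), every height `γ₀`, radius `R ≥ 1`, order
`n : ℕ` and finite set `S` of points `≠ 1`, IF every zero `ρ` of `ζ` with `0 ≤ Re ρ ≤ 1`,
`|Im ρ − γ₀| < R`, `ρ ∉ S` lies on the critical line (local RH near `γ₀`, up to `S`), then for
every `T`, with `g = h·e^{−iγ₀t}`,
`∑_{ρ ∈ weilZeroIndex T} m(ρ)|ĝ(ρ)|² ≤ 2A₁((‖h‖₁² + ‖h′‖₁²) + 2e^{a}‖h⁽ⁿ⁺¹⁾‖₁²/R^{2n}) log(|γ₀|+2)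
   + ∑_{ρ ∈ S} m(ρ)|ĝ(ρ)|²`.
The main term carries no `e^{a}`. -/
theorem exists_weilSamplingEnergy_le_local :
    ∃ A₁ : ℝ, 0 < A₁ ∧ ∀ (h : ℝ → ℂ) (a γ₀ R : ℝ) (n : ℕ) (S : Finset ℂ), IsWeilTest h →
      0 ≤ a → 1 ≤ R → tsupport h ⊆ Icc (-a) a → (∀ ρ ∈ S, ρ ≠ 1) →
      (∀ ρ : ℂ, riemannZeta ρ = 0 → 0 ≤ ρ.re → ρ.re ≤ 1 → |ρ.im - γ₀| < R → ρ ∉ S →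
          ρ.re = 1 / 2) →
      ∀ T : ℝ,
        ∑ᶠ ρ ∈ weilZeroIndex T, (riemannZetaZeroOrder ρ : ℝ) *
            ‖weilMellin (fun t ↦ h t * cexp (-(γ₀ * I) * t)) ρ‖ ^ 2
          ≤ 2 * A₁ * (((∫ t : ℝ, ‖h t‖) ^ 2 + (∫ t : ℝ, ‖deriv h t‖) ^ 2)
                + 2 * Real.exp a * (∫ t : ℝ, ‖iteratedDeriv (n + 1) h t‖) ^ 2 / R ^ (2 * n))
              * Real.log (|γ₀| + 2)
            + ∑ ρ ∈ S, (riemannZetaZeroOrder ρ : ℝ) *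
                ‖weilMellin (fun t ↦ h t * cexp (-(γ₀ * I) * t)) ρ‖ ^ 2 := by
  obtain ⟨A₁, hA₁, hK⟩ := exists_finsum_weilZeroIndex_le_of_kernel_bound_off
  refine ⟨A₁, hA₁, fun h a γ₀ R n S hh ha hR hhs hS1 hloc T ↦ ?_⟩
  classical
  set g : ℝ → ℂ := fun t ↦ h t * cexp (-(γ₀ * I) * t) with hg
  set Mn : ℝ := (∫ t : ℝ, ‖h t‖) ^ 2 + (∫ t : ℝ, ‖deriv h t‖) ^ 2 with hMn
  set Mf : ℝ := 2 * Real.exp a * (∫ t : ℝ, ‖iteratedDeriv (n + 1) h t‖) ^ 2 / R ^ (2 * n)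
    with hMf
  have hR0 : 0 < R := by linarith
  have hMn0 : 0 ≤ Mn := by positivity
  have hMf0 : 0 ≤ Mf := by positivity
  set F : ℂ → ℝ := fun ρ ↦ if riemannZeta ρ = 0 then ‖weilMellin g ρ‖ ^ 2 else 0 with hF
  have hF0 : ∀ ρ, 0 ≤ F ρ := fun ρ ↦ by
    by_cases hz : riemannZeta ρ = 0
    · simp only [hF, hz, if_true]; positivity
    · simp only [hF, hz, if_false]; exact le_rfl
  have hFle : ∀ ρ, F ρ ≤ ‖weilMellin g ρ‖ ^ 2 := fun ρ ↦ by
    by_cases hz : riemannZeta ρ = 0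
    · simp only [hF, hz, if_true]; exact le_rfl
    · simp only [hF, hz, if_false]; positivity
  have hmaj : ∀ ρ : ℂ, 0 ≤ ρ.re → ρ.re ≤ 1 → ρ ∉ S →
      F ρ ≤ (Mn + Mf) / (1 + (ρ.im - γ₀) ^ 2) := by
    intro ρ h0 h1 hρS
    have hden : 0 < 1 + (ρ.im - γ₀) ^ 2 := by positivity
    by_cases hz : riemannZeta ρ = 0
    · have hFρ : F ρ = ‖weilMellin g ρ‖ ^ 2 := by simp only [hF, hz, if_true]
      rw [hFρ]
      by_cases hnear : |ρ.im - γ₀| < R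
      · have hre := hloc ρ hz h0 h1 hnear hρS
        calc ‖weilMellin g ρ‖ ^ 2 ≤ Mn / (1 + (ρ.im - γ₀) ^ 2) :=
              norm_sq_weilMellin_twist_le_kernel_critical hh hhs γ₀ hre
          _ ≤ (Mn + Mf) / (1 + (ρ.im - γ₀) ^ 2) := by gcongr; linarith
      · have hfar : R ≤ |ρ.im - γ₀| := not_lt.mp hnear
        calc ‖weilMellin g ρ‖ ^ 2 ≤ Mf / (1 + (ρ.im - γ₀) ^ 2) :=
              norm_sq_weilMellin_twist_le_kernel_far hh ha hhs γ₀ n hR h0 h1 hfar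
          _ ≤ (Mn + Mf) / (1 + (ρ.im - γ₀) ^ 2) := by gcongr; linarith
    · simp only [hF, hz, if_false]; positivity
  have hK' := hK F (Mn + Mf) γ₀ S (by positivity) hF0 hS1 hmaj T
  have hcongr : ∑ᶠ ρ ∈ weilZeroIndex T, (riemannZetaZeroOrder ρ : ℝ) * F ρ =
      ∑ᶠ ρ ∈ weilZeroIndex T, (riemannZetaZeroOrder ρ : ℝ) * ‖weilMellin g ρ‖ ^ 2 :=
    finsum_mem_congr rfl fun ρ hρ ↦ by
      have hz : riemannZeta ρ = 0 := hρ.1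
      simp only [hF, hz, if_true]
  rw [← hcongr]
  refine hK'.trans (add_le_add le_rfl (Finset.sum_le_sum fun ρ hρ ↦ ?_))
  exact mul_le_mul_of_nonneg_left (hFle ρ)
    (by exact_mod_cast riemannZetaZeroOrder_nonneg (hS1 ρ hρ))

/-- **Conditional visibility inequality (T12 = T5 ∘ T7 ∘ T11).** With the absolute `A₁` of
`exists_weilSamplingEnergy_le_local`: let `h` be an odd Weil test supported in `[-a, a]`
(`a ≥ 0`), `τ` real with `k = D_τ h ≠ 0` in `L²`, `ρ₀ = ½ + η + iγ₀` a zero of `ζ` with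
`0 < |η| < ½`, `γ₀ ≠ 0`, `R ≥ 1`, `n : ℕ`, and suppose that every zero `ρ` with `0 ≤ Re ρ ≤ 1`,
`|Im ρ − γ₀| < R` off the critical line is `ρ₀` or its reflection `ρ₀* = ½ − η + iγ₀` (local RH
near `γ₀` up to the pair).  Then
`ε(a)·‖k‖₂² ≤ 2A₁((‖k‖₁² + ‖k′‖₁²) + 2e^{a}‖k⁽ⁿ⁺¹⁾‖₁²/R^{2n}) log(|γ₀|+2) − 2m(ρ₀)(η²+τ²)²|∫ h e^{ηt}|²`.
The main term has no `e^{a}`; compare `weilGroundEnergy_le_explicit_of_oddDipole`. -/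
theorem weilGroundEnergy_le_local_of_oddDipole :
    ∃ A₁ : ℝ, 0 < A₁ ∧ ∀ (h : ℝ → ℂ) (a τ η γ₀ R : ℝ) (n : ℕ), IsWeilTest h →
      (∀ t, h (-t) = -h t) → 0 ≤ a → 1 ≤ R → tsupport h ⊆ Icc (-a) a →
      0 < ∫ t, ‖weilDodge τ h t‖ ^ 2 → riemannZeta (1 / 2 + η + γ₀ * I) = 0 → |η| < 1 / 2 →
      η ≠ 0 → γ₀ ≠ 0 →
      (∀ ρ : ℂ, riemannZeta ρ = 0 → 0 ≤ ρ.re → ρ.re ≤ 1 → |ρ.im - γ₀| < R → ρ.re ≠ 1 / 2 →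
          ρ = 1 / 2 + η + γ₀ * I ∨ ρ = 1 / 2 - η + γ₀ * I) →
        weilGroundEnergy a ≤
          (2 * A₁ * (((∫ t : ℝ, ‖weilDodge τ h t‖) ^ 2 + (∫ t : ℝ, ‖deriv (weilDodge τ h) t‖) ^ 2)
                + 2 * Real.exp a * (∫ t : ℝ, ‖iteratedDeriv (n + 1) (weilDodge τ h) t‖) ^ 2
                    / R ^ (2 * n)) * Real.log (|γ₀| + 2)
            - 2 * ((riemannZetaZeroOrder (1 / 2 + η + γ₀ * I) : ℝ)
                * ((η ^ 2 + τ ^ 2) ^ 2 * ‖∫ t : ℝ, h t * cexp ((η : ℂ) * t)‖ ^ 2)))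
            / ∫ t, ‖weilDodge τ h t‖ ^ 2 := by
  obtain ⟨A₁, hA₁, hS⟩ := exists_weilSamplingEnergy_le_local
  refine ⟨A₁, hA₁, fun h a τ η γ₀ R n hh hodd ha hR hhs hpos hζ hη hη0 hγ hloc ↦ ?_⟩
  classical
  set ρ₀ : ℂ := 1 / 2 + η + γ₀ * I with hρ₀
  set ρ₁ : ℂ := 1 / 2 - η + γ₀ * I with hρ₁
  set G : ℝ := (η ^ 2 + τ ^ 2) ^ 2 * ‖∫ t : ℝ, h t * cexp ((η : ℂ) * t)‖ ^ 2 with hG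
  have hkW : IsWeilTest (weilDodge τ h) := isWeilTest_weilDodge hh τ
  have hks : tsupport (weilDodge τ h) ⊆ Icc (-a) a := (tsupport_weilDodge_subset τ h).trans hhs
  have hne : ρ₀ ≠ ρ₁ := by
    intro h01
    have := congrArg Complex.re h01
    simp [hρ₀, hρ₁] at this
    exact hη0 (by linarith)
  have hρ₀1 : ρ₀ ≠ 1 := by
    intro h1
    have := congrArg Complex.im h1
    simp [hρ₀] at this
    exact hγ this
  have hρ₁1 : ρ₁ ≠ 1 := by
    intro h1
    have := congrArg Complex.im h1
    simp [hρ₁] at this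
    exact hγ this
  have hS1 : ∀ ρ ∈ ({ρ₀, ρ₁} : Finset ℂ), ρ ≠ 1 := by
    intro ρ hρ
    rcases Finset.mem_insert.mp hρ with h0 | h1
    · rw [h0]; exact hρ₀1
    · rw [Finset.mem_singleton.mp h1]; exact hρ₁1
  have hloc' : ∀ ρ : ℂ, riemannZeta ρ = 0 → 0 ≤ ρ.re → ρ.re ≤ 1 → |ρ.im - γ₀| < R →
      ρ ∉ ({ρ₀, ρ₁} : Finset ℂ) → ρ.re = 1 / 2 := by
    intro ρ hz h0 h1 hnear hρS
    by_contra hre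
    rcases hloc ρ hz h0 h1 hnear hre with h | h
    · exact hρS (by rw [h]; simp)
    · exact hρS (by rw [h]; simp)
  have hB := hS (weilDodge τ h) a γ₀ R n {ρ₀, ρ₁} hkW ha hR hks hS1 hloc'
  -- the two exceptional values
  have e1 : ∀ (f : ℝ → ℂ) (c : ℝ), ∫ t : ℝ, f t * cexp ((c : ℂ) * t) = weilMellin f (1 / 2 + c) := by
    intro f c; unfold weilMellin; congr 1 with t; congr 2; ring
  have hfac : ∀ c : ℝ, (-((1 : ℂ) / 2 + c - 1 / 2) ^ 2 - (τ : ℂ) ^ 2) =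
      ((-(c ^ 2 + τ ^ 2) : ℝ) : ℂ) := by
    intro c; push_cast; ring
  have hval : ∀ c : ℝ, ‖weilMellin (fun t ↦ weilDodge τ h t * cexp (-(γ₀ * I) * t))
      (1 / 2 + c + γ₀ * I)‖ ^ 2 = (c ^ 2 + τ ^ 2) ^ 2 * ‖∫ t : ℝ, h t * cexp ((c : ℂ) * t)‖ ^ 2 := by
    intro c
    rw [weilMellin_mul_cexp]
    have e0 : (1 / 2 + (c : ℂ) + γ₀ * I + -(γ₀ * I)) = 1 / 2 + c := by ring
    rw [e0, weilMellin_weilDodge (contDiff_two_of_isWeilTest hh) hh.2, norm_mul, mul_pow, hfac c,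
      Complex.norm_real, Real.norm_eq_abs, sq_abs, e1]
    ring
  have hval0 : ‖weilMellin (fun t ↦ weilDodge τ h t * cexp (-(γ₀ * I) * t)) ρ₀‖ ^ 2 = G := by
    rw [hρ₀, hval η]
  have hval1 : ‖weilMellin (fun t ↦ weilDodge τ h t * cexp (-(γ₀ * I) * t)) ρ₁‖ ^ 2 = G := by
    have e : ρ₁ = 1 / 2 + ((-η : ℝ) : ℂ) + γ₀ * I := by rw [hρ₁]; push_cast; ring
    rw [e, hval (-η), hG]
    have hint : ∫ t : ℝ, h t * cexp (((-η : ℝ) : ℂ) * t) = -∫ t : ℝ, h t * cexp ((η : ℂ) * t) := by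
      rw [← integral_odd_mul_cexp_neg hodd η]
      congr 1 with t; push_cast; ring_nf
    rw [hint, norm_neg]
    ring
  have hm1 : (riemannZetaZeroOrder ρ₁ : ℝ) = riemannZetaZeroOrder ρ₀ := by
    have e : ρ₁ = conj (1 - ρ₀) := by
      apply Complex.ext
      · simp [hρ₀, hρ₁]; ring
      · simp [hρ₀, hρ₁]
    have h0 : 0 < ρ₀.re := by
      have := (abs_lt.mp hη).1
      simp [hρ₀]; linarith
    have h1 : ρ₀.re < 1 := by
      have := (abs_lt.mp hη).2
      simp [hρ₀]; linarith
    rw [e, riemannZetaZeroOrder_conj_holds (1 - ρ₀), riemannZetaZeroOrder_one_sub_holds h0 h1]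
  have hsum : ∑ ρ ∈ ({ρ₀, ρ₁} : Finset ℂ), (riemannZetaZeroOrder ρ : ℝ) *
      ‖weilMellin (fun t ↦ weilDodge τ h t * cexp (-(γ₀ * I) * t)) ρ‖ ^ 2 =
      2 * ((riemannZetaZeroOrder ρ₀ : ℝ) * G) := by
    rw [Finset.sum_pair hne, hval0, hval1, hm1]
    ring
  simp_rw [hsum] at hB
  have key := weilGroundEnergy_le_of_oddDipole_weilDodge hh hodd hhs τ hpos hζ hη.le hγ hB
  refine key.trans_eq ?_
  congr 1
  ring

end Summit.RiemannHypothesis.RiemannHypothesis.Theorems
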